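import Mathlib
import Literature.Analysis.Calculus.JointSmoothnessPartials

/-!
# Route PhotonSphereChannels · BlindnessInsidePhotonSphere — calculus helpers: partial
# derivatives on `ℝ × ℝ` and the Leibniz integral rule with variable limits

Support file (pure analysis, everything proved) for item stmt-FinalStateConjecture-10049.
The Leibniz rule `d/da ∫_b^a k(a, s) ds = k(a, a) + ∫_b^a ∂_a k(a, s) ds` for `k, ∂_a k` jointly
continuous (`hasDerivAt_integral_param_upper`, and its mirror image
`hasDerivAt_integral_param_lower`), obtained from Mathlib's fundamental theorem of calculus and
dominated differentiation under the integral sign, glued into a total derivative by the tree's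
`Literature.Analysis.Calculus.hasFDerivAt_of_partial` (Dieudonné (8.9.1)) and restricted to the
diagonal. No definitions are introduced.
-/

noncomputable section

open Set Filter MeasureTheory intervalIntegral Topology Function
open scoped Interval

namespace Summit.FinalStateConjecture.FinalStateConjecture.Theorems.Blindness

/-! ### Calculus helpers on `ℝ × ℝ` -/

/-- Partial derivative in the first variable from the total derivative. -/
theorem hasDerivAt_fst_of_hasFDerivAt {f : ℝ × ℝ → ℝ} {L : ℝ × ℝ →L[ℝ] ℝ} {p : ℝ × ℝ}
    (h : HasFDerivAt f L p) : HasDerivAt (fun a => f (a, p.2)) (L (1, 0)) p.1 := by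
  have h1 : HasDerivAt (fun a : ℝ => (a, p.2)) ((1 : ℝ), (0 : ℝ)) p.1 :=
    (hasDerivAt_id p.1).prodMk (hasDerivAt_const p.1 p.2)
  exact h.comp_hasDerivAt p.1 h1

/-- Partial derivative in the second variable from the total derivative. -/
theorem hasDerivAt_snd_of_hasFDerivAt {f : ℝ × ℝ → ℝ} {L : ℝ × ℝ →L[ℝ] ℝ} {p : ℝ × ℝ}
    (h : HasFDerivAt f L p) : HasDerivAt (fun b => f (p.1, b)) (L (0, 1)) p.2 := by
  have h1 : HasDerivAt (fun b : ℝ => (p.1, b)) ((0 : ℝ), (1 : ℝ)) p.2 :=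
    (hasDerivAt_const p.2 p.1).prodMk (hasDerivAt_id p.2)
  exact h.comp_hasDerivAt p.2 h1

/-- A scalar derivative as a Fréchet derivative `d • 1`. -/
theorem hasFDerivAt_smul_one_of_hasDerivAt {f : ℝ → ℝ} {d x : ℝ} (h : HasDerivAt f d x) :
    HasFDerivAt f (d • (1 : ℝ →L[ℝ] ℝ)) x :=
  h.hasFDerivAt.congr_fderiv (by ext; simp)

/-- **Leibniz rule**, variable upper limit: for `k, ∂_a k` jointly continuous,
`d/da ∫_b^a k(a, s) ds = k(a, a) + ∫_b^a ∂_a k(a, s) ds`. -/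
theorem hasDerivAt_integral_param_upper {k k₁ : ℝ → ℝ → ℝ} (hk : Continuous (uncurry k))
    (hk₁ : Continuous (uncurry k₁)) (hder : ∀ a s, HasDerivAt (fun a => k a s) (k₁ a s) a)
    (b a : ℝ) :
    HasDerivAt (fun a => ∫ s in b..a, k a s) (k a a + ∫ s in b..a, k₁ a s) a := by
  have hka : ∀ a, Continuous (k a) := fun a => hk.comp (Continuous.prodMk_right a)
  have hk₁a : ∀ a, Continuous (k₁ a) := fun a => hk₁.comp (Continuous.prodMk_right a)
  -- `F (α, a) = ∫_b^α k(a, s) ds`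
  set F : ℝ × ℝ → ℝ := fun p => ∫ s in b..p.1, k p.2 s with hF
  -- ∂/∂α : the fundamental theorem of calculus
  have h1 : ∀ p : ℝ × ℝ, HasDerivAt (fun α => F (α, p.2)) (k p.2 p.1) p.1 := fun p =>
    integral_hasDerivAt_right ((hka p.2).intervalIntegrable _ _)
      ((hka p.2).stronglyMeasurableAtFilter _ _) (hka p.2).continuousAt
  -- ∂/∂a : dominated differentiation on the compact `[a₀-1, a₀+1] × [[b, α]]`
  have h2 : ∀ p : ℝ × ℝ, HasDerivAt (fun a => F (p.1, a)) (∫ s in b..p.1, k₁ p.2 s) p.2 := by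
    rintro ⟨α, a₀⟩
    obtain ⟨M, hM⟩ : ∃ M, ∀ z ∈ Icc (a₀ - 1) (a₀ + 1) ×ˢ uIcc b α, |uncurry k₁ z| ≤ M := by
      obtain ⟨M, hM⟩ := (isCompact_Icc.prod isCompact_uIcc).exists_bound_of_continuousOn
        (hk₁.continuousOn (s := Icc (a₀ - 1) (a₀ + 1) ×ˢ uIcc b α))
      exact ⟨M, fun z hz => by simpa [Real.norm_eq_abs] using hM z hz⟩
    have key := intervalIntegral.hasDerivAt_integral_of_dominated_loc_of_deriv_le
      (𝕜 := ℝ) (μ := volume) (a := b) (b := α) (F := fun a s => k a s) (F' := fun a s => k₁ a s)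
      (x₀ := a₀) (s := Icc (a₀ - 1) (a₀ + 1)) (bound := fun _ => M)
      (Icc_mem_nhds (by linarith) (by linarith))
      (Eventually.of_forall fun a => (hka a).aestronglyMeasurable)
      ((hka a₀).intervalIntegrable _ _) (hk₁a a₀).aestronglyMeasurable ?_
      intervalIntegrable_const ?_
    · exact key.2
    · refine Eventually.of_forall fun s hs a ha => ?_
      simpa [Real.norm_eq_abs] using hM (a, s) (mk_mem_prod ha (uIoc_subset_uIcc hs))
    · exact Eventually.of_forall fun s _ a _ => hder a s
  -- joint differentiability from the partial derivatives (Dieudonné 8.9.1)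
  have hFd : HasFDerivAt F (((k a a) • (1 : ℝ →L[ℝ] ℝ)).comp (ContinuousLinearMap.fst ℝ ℝ ℝ) +
      ((∫ s in b..a, k₁ a s) • (1 : ℝ →L[ℝ] ℝ)).comp (ContinuousLinearMap.snd ℝ ℝ ℝ)) (a, a) := by
    have hc : Continuous fun p : ℝ × ℝ => (k p.2 p.1) • (1 : ℝ →L[ℝ] ℝ) :=
      (hk.comp (continuous_snd.prodMk continuous_fst)).smul continuous_const
    exact Literature.Analysis.Calculus.hasFDerivAt_of_partial
      (f₁ := fun p : ℝ × ℝ => (k p.2 p.1) • (1 : ℝ →L[ℝ] ℝ))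
      (Eventually.of_forall fun p => hasFDerivAt_smul_one_of_hasDerivAt (h1 p)) hc.continuousAt
      (hasFDerivAt_smul_one_of_hasDerivAt (h2 (a, a)))
  -- restrict to the diagonal
  have hdiag : HasDerivAt (fun a : ℝ => (a, a)) ((1 : ℝ), (1 : ℝ)) a :=
    (hasDerivAt_id a).prodMk (hasDerivAt_id a)
  have h := HasFDerivAt.comp_hasDerivAt (f := fun a : ℝ => (a, a)) a hFd hdiag
  have h' : HasDerivAt (fun a => ∫ s in b..a, k a s)
      ((((k a a) • (1 : ℝ →L[ℝ] ℝ)).comp (ContinuousLinearMap.fst ℝ ℝ ℝ) +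
        ((∫ s in b..a, k₁ a s) • (1 : ℝ →L[ℝ] ℝ)).comp (ContinuousLinearMap.snd ℝ ℝ ℝ))
          ((1 : ℝ), (1 : ℝ))) a :=
    h.congr_of_eventuallyEq (Eventually.of_forall fun x => rfl)
  refine h'.congr_deriv ?_
  simp

/-- **Leibniz rule**, variable lower limit: for `k, ∂_b k` jointly continuous,
`d/db ∫_b^a k(s, b) ds = −k(b, b) + ∫_b^a ∂_b k(s, b) ds`. -/
theorem hasDerivAt_integral_param_lower {k k₂ : ℝ → ℝ → ℝ} (hk : Continuous (uncurry k))
    (hk₂ : Continuous (uncurry k₂)) (hder : ∀ s b, HasDerivAt (fun b => k s b) (k₂ s b) b)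
    (a b : ℝ) :
    HasDerivAt (fun b => ∫ s in b..a, k s b) (-k b b + ∫ s in b..a, k₂ s b) b := by
  have h := hasDerivAt_integral_param_upper (k := fun b s => k s b) (k₁ := fun b s => k₂ s b)
    (hk.comp continuous_swap) (hk₂.comp continuous_swap) (fun b s => hder s b) a b
  have h' : HasDerivAt (fun b => ∫ s in b..a, k s b) (-(k b b + ∫ s in a..b, k₂ s b)) b :=
    h.neg.congr_of_eventuallyEq (Eventually.of_forall fun x => by
      simp only [Pi.neg_apply, integral_symm a x])
  refine h'.congr_deriv ?_
  simp only [integral_symm a b]; ring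

end Summit.FinalStateConjecture.FinalStateConjecture.Theorems.Blindness

end
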